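import Summits.BirchSwinnertonDyer.BirchSwinnertonDyer.Theorems.KimAtThreeFineKatoKPortSatLog
import Summits.BirchSwinnertonDyer.Rank1Residual.Additive.PadicBallLogSurj
import Summits.BirchSwinnertonDyer.Rank1Residual.Additive.KobayashiLogFssValues
import Mathlib.Analysis.SpecificLimits.Basic
import HarnessLib

/-!
# K-PORT glue (G6): the logarithm of `E₁(K)` is onto EVERY closed ball of radius `ρ < 1/2` — hence, for
# `p` odd and `K ⊇ ℚ_p` unramified, `log_ω : E₁(K) ⥲ p𝒪_K` for ANY `p`-integral model, any reduction type
# (cell `bsd-addord`, seat w2-kport gen 5; `--supports stmt-BirchSwinnertonDyer-19560`, helper)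

HONEST FRAMING. Route W2 (`route-BirchSwinnertonDyer-KimAtThreeKolyvagin`), crux 19560
`KatoKuriharaPortThreeShared` and the off-stratum items 19679 / 19599: the E-side of every "(C1)-family"
package reads the formal-group logarithm of the minimal model over the completions `K = L_w`, `w ∣ 3`
UNRAMIFIED over `ℚ₃`, and the lattice lemma of the good-anomalous rows (w2-acc3, `log_ω E(K) =
E_p(φ)⁻¹𝒪_K`) needs **`log_ω(E₁(K)) = p𝒪_K` exactly** for GOOD (not additive) reduction.  The tree had this
equality only at an ADDITIVE prime (n1011 `Additive/AdditiveFormalLogBallIsometry` §3 ⇒ kport gen 0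
`…KPortUnramified.image_satLog_kernel_of_addv`, via Honda's integrality of `log`/`exp`), while the
reduction-free surjectivity of the x1b local series, `BallEval.exists_ptLog_eq`, reaches the closed ball of
radius `1/4` only (`⟺ 9𝒪_w` at `p = 3`: the "`c = 2`" of `…SemiLocalTraceDualLevel` / `…DeepLowerKatoPartsLattice`
/ `…DeepUpperTowerLattice`), and the power-series-free `FormalGroupChart.image_limitLog_kernelLevel_eq`
(w2-acc3) the level `U_{|p|²}`.  THIS FILE closes the gap with x1b's own successive approximation run at
radius `ρ < 1/2` instead of `1/4`: the correction `x − Λ(pt x)` has norm `≤ 2‖x‖² ≤ 2ρ‖x‖`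
(`BallEval.norm_corr_le`), a contraction by the factor `2ρ < 1`, which is all the iteration needs.
Since `‖p‖ = p⁻¹ ≤ 1/3 < 1/2` for `p` odd, the closed ball `p𝒪_K` is covered for EVERY odd `p`, every
complete ultrametric `K ⊇ ℚ_p` and every `p`-integral model `M/ℤ_p` — Silverman's `log : Ê(𝓜ʳ) ⥲ 𝓜ʳ`
(AEC IV.6.4(b)) at `r = v(p)`, which for an UNRAMIFIED `K` (`‖x‖ < 1 ⇒ ‖x‖ ≤ ‖p‖`) is all of `E₁(K)`.
TOOL theorems only (no definition, no named fact, no `sorry`; axioms standard); closes nothing by itself;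
nothing is booked; BSD is not proved by any of this.

## What is proved (x1b notation: `E = BallEval.curveK p K M = M ⊗ K`, `E₁(K) = FormalGroupChart.kernel`,
## `Λ = BallEval.ptLog = log_E ∘ z`, `Λ̃ = KPort.satLog`, `pt x` the formal point of parameter `x`, `corr x = x − Λ(pt x)`)

* §1 (any `p`, any complete `K`): `norm_corr_le_mul` (`‖corr x‖ ≤ 2ρ‖x‖` on `‖x‖ ≤ ρ ≤ 1/2`),
  `norm_iterate_corr_le_mul_pow` (`‖corrⁿ y‖ ≤ (2ρ)ⁿ‖y‖`), `norm_iterate_corr_le_self`.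
* §2 the partial sums `Sₙ = ∑_{i<n} pt(corrⁱ y)`: `norm_zCoord_sum_le_of_le` (`‖z(Sₙ)‖ ≤ ‖y‖`),
  `norm_zCoord_sum_succ_sub_le_mul_pow` (`‖z(S_{n+1}) − z(Sₙ)‖ ≤ (2ρ)ⁿ‖y‖`).
* §3 ★ **`exists_ptLog_eq_of_norm_lt_half`: every `y` with `‖y‖ < 1/2` is `Λ(P)` for a `P ∈ E₁(K)` with
  `‖z(P)‖ = ‖y‖`**; `image_ptLog_level_eq` (`Λ(U_ρ) = B_ρ` for `ρ < 1/2`, `U_ρ = {P ∈ E₁ : ‖z P‖ ≤ ρ}`).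
* §4 `p` ODD (`norm_natCast_prime_lt_half`: `‖p‖ < 1/2`): `exists_ptLog_eq_of_norm_le_prime` (`Λ` onto `p𝒪_K`
  from `U_{‖p‖}`); with the UNRAMIFIED normalisation `hK : ∀ x, ‖x‖ < 1 → ‖x‖ ≤ ‖p‖`:
  **`norm_ptLog_eq_of_unramified`** (`‖Λ P‖ = ‖z P‖` on all of `E₁(K)`), **`ptLog_eq_zero_iff_of_unramified`**
  (`Λ P = 0 ↔ P = O`: `E₁(K)` has no torsion), `eq_of_ptLog_eq_of_unramified`, `norm_ptLog_le_norm_prime_of_unramified`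
  (`Λ(E₁(K)) ⊆ p𝒪_K`), **`exists_ptLog_eq_of_unramified`** (onto `𝔪_K = p𝒪_K`), **`image_ptLog_kernel_of_unramified`**
  (`Λ(E₁(K)) = {‖y‖ ≤ p⁻¹}`).
* §5 the same in kport's saturated-log currency `Λ̃` for ANY model `M` (twins of gen 0's `…_of_addv` theorems):
  `satLog_eq_zero_iff_isOfFinAddOrder_of_unramified` (`ker Λ̃ = torsion`), `norm_satLog_le_one_of_prime_nsmul_mem_of_unramified`
  (`p•P ∈ E₁(K) ⇒ ‖Λ̃ P‖ ≤ 1`), `exists_mem_kernel_satLog_eq_of_odd`, **`image_satLog_kernel_of_unramified`**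
  (`Λ̃(E₁(K)) = p𝒪_K`).

Consumers: w2-acc3's lattice lemma (top layer `U_{|p|}/U_{|p|²}` of its Part D, through kport gen 3's (J4a)
`satLog_eq_padicLogPointFiniteExt`); the radius `c = 2 → c = 1` at `p = 3` in the W2 lattice files above.

References: J. H. Silverman, *The Arithmetic of Elliptic Curves*, 2nd ed., GTM 106 (2009), Thm. IV.6.4(b),
Prop. VII.2.2 [SilvermanAEC2009]; S. Kobayashi, Invent. Math. 152 (2003), Prop. 8.11 (the successive
approximation) [Kobayashi2003]; kim3 brief HOME/kim3/KIM3-KPORT-BRIEF-g12.md §2–§3 (P2).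
-/

noncomputable section

-- the cell's Theorems namespace `Summit.BirchSwinnertonDyer.BirchSwinnertonDyer.…` repeats the summit name by design (D-0017)
set_option linter.dupNamespace false

open scoped Classical Topology NNReal
open Filter

namespace Summit.BirchSwinnertonDyer.BirchSwinnertonDyer.Theorems.KPort

open Summit.BirchSwinnertonDyer.Rank1Residual.Additive
open Summit.BirchSwinnertonDyer.Rank1Residual.Additive.BallEval
open Literature.NumberTheory.EllipticCurves Literature.NumberTheory.EllipticCurves.FormalGroupChart
open WeierstrassCurve

variable {p : ℕ} [hp : Fact p.Prime] {K : Type*} [NontriviallyNormedField K] [NormedAlgebra ℚ_[p] K]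
  [IsUltrametricDist K] [CompleteSpace K] {M : WeierstrassCurve ℤ_[p]}
  [hE : (M.map PadicInt.Coe.ringHom).IsElliptic]
  [hint : (curveK p K M).IsIntegral (NormedField.valuation (K := K)).integer]

/-! ## §1 The correction map contracts by the factor `2ρ` on the ball of radius `ρ ≤ 1/2` -/

omit hint in
/-- **`‖corr x‖ ≤ 2ρ‖x‖` for `‖x‖ ≤ ρ ≤ 1/2`** (from x1b's `‖corr x‖ ≤ 2‖x‖²`): on the ball of radius `ρ` the
correction map contracts by the factor `2ρ`. [folklore] -/
theorem norm_corr_le_mul {ρ : ℝ} (hρ : ρ ≤ 1 / 2) {x : K} (hx : ‖x‖ ≤ ρ) :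
    ‖corr p K M x‖ ≤ (2 * ρ) ^ 1 * ‖x‖ := by
  refine (norm_corr_le (hx.trans hρ)).trans ?_
  have h0 := norm_nonneg x
  rw [pow_one]
  nlinarith

omit hint in
/-- The iterates `rₙ = corrⁿ(y)` satisfy **`‖rₙ‖ ≤ (2ρ)ⁿ‖y‖`** for `‖y‖ ≤ ρ ≤ 1/2`. [folklore] -/
theorem norm_iterate_corr_le_mul_pow {ρ : ℝ} (hρ : ρ ≤ 1 / 2) {y : K} (hy : ‖y‖ ≤ ρ) (n : ℕ) :
    ‖(corr p K M)^[n] y‖ ≤ (2 * ρ) ^ n * ‖y‖ := by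
  have hρ0 : 0 ≤ ρ := (norm_nonneg y).trans hy
  have h2ρ0 : 0 ≤ 2 * ρ := by linarith
  have h2ρ : 2 * ρ ≤ 1 := by linarith
  induction n with
  | zero => simp
  | succ n ih =>
    rw [Function.iterate_succ_apply']
    have hn : ‖(corr p K M)^[n] y‖ ≤ ρ := by
      refine ih.trans ?_
      calc (2 * ρ) ^ n * ‖y‖ ≤ 1 * ‖y‖ :=
            mul_le_mul_of_nonneg_right (pow_le_one₀ h2ρ0 h2ρ) (norm_nonneg y)
        _ ≤ ρ := by rw [one_mul]; exact hy
    refine (norm_corr_le_mul hρ hn).trans ?_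
    rw [pow_one, pow_succ]
    calc 2 * ρ * ‖(corr p K M)^[n] y‖ ≤ 2 * ρ * ((2 * ρ) ^ n * ‖y‖) :=
          mul_le_mul_of_nonneg_left ih h2ρ0
      _ = (2 * ρ) ^ n * (2 * ρ) * ‖y‖ := by ring

omit hint in
/-- Hence `‖rₙ‖ ≤ ‖y‖` (the iterates stay in the ball). [folklore] -/
theorem norm_iterate_corr_le_self {ρ : ℝ} (hρ : ρ ≤ 1 / 2) {y : K} (hy : ‖y‖ ≤ ρ) (n : ℕ) :
    ‖(corr p K M)^[n] y‖ ≤ ‖y‖ := by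
  have hρ0 : 0 ≤ ρ := (norm_nonneg y).trans hy
  refine (norm_iterate_corr_le_mul_pow hρ hy n).trans ?_
  calc (2 * ρ) ^ n * ‖y‖ ≤ 1 * ‖y‖ :=
        mul_le_mul_of_nonneg_right (pow_le_one₀ (by linarith) (by linarith)) (norm_nonneg y)
    _ = ‖y‖ := one_mul _

/-! ## §2 The partial sums `Sₙ = ∑_{i<n} pt(rᵢ)` at radius `ρ` -/

/-- `‖z(Sₙ)‖ ≤ ‖y‖` for `‖y‖ ≤ ρ ≤ 1/2`. [folklore] -/
theorem norm_zCoord_sum_le_of_le {ρ : ℝ} (hρ : ρ ≤ 1 / 2) {y : K} (hy : ‖y‖ ≤ ρ) (n : ℕ) :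
    ‖(∑ i ∈ Finset.range n, pt p K M ((corr p K M)^[i] y)).zCoord‖ ≤ ‖y‖ := by
  induction n with
  | zero => rw [Finset.sum_range_zero, Affine.Point.zCoord_zero, norm_zero]; exact norm_nonneg y
  | succ n ih =>
    rw [Finset.sum_range_succ]
    refine (norm_zCoord_add_le (sum_pt_mem_kernel y n) (pt_mem_kernel _)).trans (max_le ih ?_)
    have h1 : ‖(corr p K M)^[n] y‖ < 1 :=
      (norm_iterate_corr_le_self hρ hy n).trans_lt (hy.trans_lt (hρ.trans_lt (by norm_num)))
    rw [zCoord_pt h1]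
    exact norm_iterate_corr_le_self hρ hy n

/-- Consecutive differences: `‖z(S_{n+1}) − z(Sₙ)‖ ≤ (2ρ)ⁿ‖y‖`. [folklore] -/
theorem norm_zCoord_sum_succ_sub_le_mul_pow {ρ : ℝ} (hρ : ρ ≤ 1 / 2) {y : K} (hy : ‖y‖ ≤ ρ) (n : ℕ) :
    ‖(∑ i ∈ Finset.range (n + 1), pt p K M ((corr p K M)^[i] y)).zCoord -
      (∑ i ∈ Finset.range n, pt p K M ((corr p K M)^[i] y)).zCoord‖ ≤ (2 * ρ) ^ n * ‖y‖ := by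
  have h1 : ‖(corr p K M)^[n] y‖ < 1 :=
    (norm_iterate_corr_le_self hρ hy n).trans_lt (hy.trans_lt (hρ.trans_lt (by norm_num)))
  rw [← norm_zCoord_sub_eq (sum_pt_mem_kernel y (n + 1)) (sum_pt_mem_kernel y n), Finset.sum_range_succ,
    add_sub_cancel_left, zCoord_pt h1]
  exact norm_iterate_corr_le_mul_pow hρ hy n

/-! ## §3 Surjectivity of `Λ` onto every closed ball of radius `< 1/2` -/

/-- ★ **`Λ` is onto the open ball of radius `1/2`, level by level**: for every `y ∈ K` with `‖y‖ < 1/2` there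
is `P ∈ E₁(K)` with `Λ(P) = y` and `‖z(P)‖ = ‖y‖` (successive approximation at radius `ρ = ‖y‖`, contraction
factor `2ρ < 1`; the last clause by the isometry `‖Λ‖ = ‖z‖` below `1/2`).  Supersedes the radius `1/4` of
x1b's `BallEval.exists_ptLog_eq`. [cite: SilvermanAEC2009, IV.6.4] -/
theorem exists_ptLog_eq_of_norm_lt_half {y : K} (hy : ‖y‖ < 1 / 2) :
    ∃ P ∈ kernel (NormedField.valuation (K := K)) (curveK p K M), ptLog p K M P = y ∧ ‖P.zCoord‖ = ‖y‖ := by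
  have hθ0 : 0 ≤ 2 * ‖y‖ := by positivity
  have hθ1 : 2 * ‖y‖ < 1 := by linarith
  have hρ : ‖y‖ ≤ 1 / 2 := hy.le
  set S : ℕ → (curveK p K M).toAffine.Point := fun n => ∑ i ∈ Finset.range n, pt p K M ((corr p K M)^[i] y)
    with hS
  set s : ℕ → K := fun n => (S n).zCoord with hs
  -- `s` is Cauchy (geometric with ratio `2‖y‖ < 1`), hence converges
  have hcau : CauchySeq s := by
    refine cauchySeq_of_le_geometric (2 * ‖y‖) ‖y‖ hθ1 fun n => ?_
    rw [dist_eq_norm, ← norm_neg, neg_sub, mul_comm]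
    exact norm_zCoord_sum_succ_sub_le_mul_pow (p := p) (M := M) hρ le_rfl n
  obtain ⟨ℓ, hℓ⟩ := cauchySeq_tendsto_of_complete hcau
  have hℓy : ‖ℓ‖ ≤ ‖y‖ :=
    le_of_tendsto (continuous_norm.continuousAt.tendsto.comp hℓ) (Filter.Eventually.of_forall fun n =>
      norm_zCoord_sum_le_of_le (p := p) (M := M) hρ le_rfl n)
  have hℓ1 : ‖ℓ‖ < 1 := hℓy.trans_lt (hy.trans (by norm_num))
  have hPm : pt p K M ℓ ∈ kernel (NormedField.valuation (K := K)) (curveK p K M) := pt_mem_kernel ℓ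
  -- `Λ(pt ℓ) = Λ(pt ℓ − Sₙ) + Λ(Sₙ)`, `Λ(Sₙ) = y − rₙ → y`, `‖Λ(pt ℓ − Sₙ)‖ = ‖ℓ − sₙ‖ → 0`
  have hlog : ptLog p K M (pt p K M ℓ) = y := by
    have key : ∀ n, ptLog p K M (pt p K M ℓ) - y =
        ptLog p K M (pt p K M ℓ - S n) - (corr p K M)^[n] y := by
      intro n
      have hadd := ptLog_add ((kernel (NormedField.valuation (K := K)) (curveK p K M)).sub_mem hPm
        (sum_pt_mem_kernel y n)) (sum_pt_mem_kernel (p := p) (K := K) (M := M) y n)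
      rw [sub_add_cancel] at hadd
      rw [hadd, ptLog_sum_pt_iterate y n]
      simp only [hS]
      ring
    rw [← sub_eq_zero, ← norm_le_zero_iff]
    refine le_of_forall_pos_le_add fun ε hε => ?_
    rw [zero_add]
    -- choose `n` with `‖ℓ − sₙ‖ < ε` (and below `1/4` for the isometry) and `(2‖y‖)ⁿ‖y‖ < ε`
    have h1 : ∀ᶠ n in atTop, ‖s n - ℓ‖ < min ε (1 / 4) :=
      (tendsto_iff_norm_sub_tendsto_zero.mp hℓ).eventually (gt_mem_nhds (lt_min hε (by norm_num)))
    have h2 : ∀ᶠ n : ℕ in atTop, (2 * ‖y‖) ^ n * ‖y‖ < ε := by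
      have ht : Tendsto (fun n : ℕ => (2 * ‖y‖) ^ n * ‖y‖) atTop (𝓝 0) := by
        have h := (tendsto_pow_atTop_nhds_zero_of_lt_one hθ0 hθ1).mul_const ‖y‖
        rwa [zero_mul] at h
      exact ht.eventually (gt_mem_nhds hε)
    obtain ⟨n, hn1, hn2⟩ := (h1.and h2).exists
    rw [key n]
    have hdiff : ‖(pt p K M ℓ - S n).zCoord‖ < min ε (1 / 4) := by
      rw [norm_zCoord_sub_eq hPm (sum_pt_mem_kernel y n), zCoord_pt hℓ1, ← norm_neg, neg_sub]
      exact hn1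
    have hL : ‖ptLog p K M (pt p K M ℓ - S n)‖ < ε := by
      rw [norm_ptLog_eq (hdiff.trans_le ((min_le_right _ _).trans (by norm_num)))]
      exact hdiff.trans_le (min_le_left _ _)
    calc ‖ptLog p K M (pt p K M ℓ - S n) - (corr p K M)^[n] y‖
        ≤ max ‖ptLog p K M (pt p K M ℓ - S n)‖ ‖(corr p K M)^[n] y‖ := by
          rw [sub_eq_add_neg]
          exact (IsUltrametricDist.norm_add_le_max _ _).trans (by rw [norm_neg])
      _ ≤ ε := max_le hL.le ((norm_iterate_corr_le_mul_pow hρ le_rfl n).trans hn2.le)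
  refine ⟨pt p K M ℓ, hPm, hlog, ?_⟩
  have hz : ‖(pt p K M ℓ).zCoord‖ < 1 / 2 := by rw [zCoord_pt hℓ1]; exact hℓy.trans_lt hy
  rw [← norm_ptLog_eq hz, hlog]

/-- **`Λ(U_ρ) = B_ρ` for every `ρ < 1/2`**: the logarithm maps the level `U_ρ = {P ∈ E₁(K) : ‖z P‖ ≤ ρ}` ONTO
the closed ball `{‖y‖ ≤ ρ}` (`⊆` is the isometry `‖Λ P‖ = ‖z P‖` below `1/2`). [cite: SilvermanAEC2009, IV.6.4] -/
theorem image_ptLog_level_eq {ρ : ℝ} (hρ : ρ < 1 / 2) :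
    ptLog p K M '' {P | P ∈ kernel (NormedField.valuation (K := K)) (curveK p K M) ∧ ‖P.zCoord‖ ≤ ρ} =
      {y : K | ‖y‖ ≤ ρ} := by
  ext y
  constructor
  · rintro ⟨P, ⟨-, hPρ⟩, rfl⟩
    rw [Set.mem_setOf_eq, norm_ptLog_eq (hPρ.trans_lt hρ)]
    exact hPρ
  · intro hy
    obtain ⟨P, hP, hPy, hPz⟩ := exists_ptLog_eq_of_norm_lt_half (p := p) (M := M) (lt_of_le_of_lt hy hρ)
    exact ⟨P, ⟨hP, by rw [hPz]; exact hy⟩, hPy⟩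

/-! ## §4 Odd `p`: `Λ` onto `p𝒪_K`; unramified `K`: `log_ω : E₁(K) ⥲ 𝔪_K = p𝒪_K` -/

omit [IsUltrametricDist K] [CompleteSpace K] in
/-- For `p` odd, `‖p‖ = p⁻¹ ≤ 1/3 < 1/2` in `K`: the closed ball `p𝒪_K` lies inside the domain of §3. [folklore] -/
theorem norm_natCast_prime_lt_half (hp2 : p ≠ 2) : ‖(p : K)‖ < 1 / 2 := by
  rw [HondaFss.norm_natCast_p (p := p) (K := K)]
  have h3 : (3 : ℝ) ≤ p := by exact_mod_cast lt_of_le_of_ne hp.out.two_le (Ne.symm hp2)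
  calc ((p : ℝ))⁻¹ ≤ (3 : ℝ)⁻¹ := inv_anti₀ (by norm_num) h3
    _ < 1 / 2 := by norm_num

/-- **`p` odd: `Λ` maps `U_{‖p‖} ⊆ E₁(K)` ONTO `p𝒪_K`** — every `y` with `‖y‖ ≤ ‖p‖` is `Λ(P)`, `P ∈ E₁(K)`,
`‖z P‖ = ‖y‖`; any complete ultrametric `K ⊇ ℚ_p`, any `p`-integral model `M`, any reduction type
(Silverman IV.6.4(b) at `r = v(p)`, admissible since `v(p) > v(p)/(p − 1)` for `p ≥ 3`). [cite: SilvermanAEC2009, IV.6.4] -/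
theorem exists_ptLog_eq_of_norm_le_prime (hp2 : p ≠ 2) {y : K} (hy : ‖y‖ ≤ ‖(p : K)‖) :
    ∃ P ∈ kernel (NormedField.valuation (K := K)) (curveK p K M), ptLog p K M P = y ∧ ‖P.zCoord‖ = ‖y‖ :=
  exists_ptLog_eq_of_norm_lt_half (hy.trans_lt (norm_natCast_prime_lt_half hp2))

omit hE in
/-- **Unramified `K`, `p` odd: `‖Λ(P)‖ = ‖z(P)‖` on ALL of `E₁(K)`** (`‖z P‖ < 1 ⇒ ‖z P‖ ≤ ‖p‖ < 1/2`, and `Λ`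
is an isometry below `1/2`). [cite: SilvermanAEC2009, IV.6.4] -/
theorem norm_ptLog_eq_of_unramified (hp2 : p ≠ 2) (hK : ∀ x : K, ‖x‖ < 1 → ‖x‖ ≤ ‖(p : K)‖)
    {P : (curveK p K M).toAffine.Point} (hP : P ∈ kernel (NormedField.valuation (K := K)) (curveK p K M)) :
    ‖ptLog p K M P‖ = ‖P.zCoord‖ :=
  norm_ptLog_eq ((hK _ (norm_zCoord_lt_one hP)).trans_lt (norm_natCast_prime_lt_half hp2))

omit hE in
/-- **Unramified `K`, `p` odd: `Λ(E₁(K)) ⊆ p𝒪_K`** (`‖Λ P‖ = ‖z P‖ < 1`, hence `≤ ‖p‖`). [cite: SilvermanAEC2009, IV.6.4] -/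
theorem norm_ptLog_le_norm_prime_of_unramified (hp2 : p ≠ 2) (hK : ∀ x : K, ‖x‖ < 1 → ‖x‖ ≤ ‖(p : K)‖)
    {P : (curveK p K M).toAffine.Point} (hP : P ∈ kernel (NormedField.valuation (K := K)) (curveK p K M)) :
    ‖ptLog p K M P‖ ≤ ‖(p : K)‖ := by
  rw [norm_ptLog_eq_of_unramified hp2 hK hP]
  exact hK _ (norm_zCoord_lt_one hP)

omit hE in
/-- **Unramified `K`, `p` odd: `Λ` is INJECTIVE on `E₁(K)`** — `Λ(P) = 0 ↔ P = O`; in particular `E₁(K)` has no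
torsion (compare x1b's general `exists_pow_smul_eq_zero_of_ptLog_eq_zero`). [cite: SilvermanAEC2009, IV.6.4] -/
theorem ptLog_eq_zero_iff_of_unramified (hp2 : p ≠ 2) (hK : ∀ x : K, ‖x‖ < 1 → ‖x‖ ≤ ‖(p : K)‖)
    {P : (curveK p K M).toAffine.Point} (hP : P ∈ kernel (NormedField.valuation (K := K)) (curveK p K M)) :
    ptLog p K M P = 0 ↔ P = 0 := by
  refine ⟨fun h0 ↦ ?_, fun h0 ↦ by rw [h0, ptLog_zero]⟩
  have hz : ‖P.zCoord‖ = 0 := by rw [← norm_ptLog_eq_of_unramified hp2 hK hP, h0, norm_zero]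
  exact (zCoord_eq_zero_iff hP).mp (norm_eq_zero.mp hz)

/-- Injectivity as a statement about pairs: `Λ(P) = Λ(Q) → P = Q` on `E₁(K)` (unramified `K`, `p` odd).
[cite: SilvermanAEC2009, IV.6.4] -/
theorem eq_of_ptLog_eq_of_unramified (hp2 : p ≠ 2) (hK : ∀ x : K, ‖x‖ < 1 → ‖x‖ ≤ ‖(p : K)‖)
    {P Q : (curveK p K M).toAffine.Point} (hP : P ∈ kernel (NormedField.valuation (K := K)) (curveK p K M))
    (hQ : Q ∈ kernel (NormedField.valuation (K := K)) (curveK p K M)) (h : ptLog p K M P = ptLog p K M Q) :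
    P = Q := by
  have hPQ : P - Q ∈ kernel (NormedField.valuation (K := K)) (curveK p K M) :=
    (kernel (NormedField.valuation (K := K)) (curveK p K M)).sub_mem hP hQ
  have hsub : ptLog p K M (P - Q) = 0 := by
    have hadd := ptLog_add hPQ hQ
    rw [sub_add_cancel] at hadd
    rw [hadd] at h
    linear_combination h
  exact sub_eq_zero.mp ((ptLog_eq_zero_iff_of_unramified hp2 hK hPQ).mp hsub)

/-- **Unramified `K`, `p` odd: `Λ : E₁(K) → 𝔪_K` is ONTO** — every `y` with `‖y‖ < 1` is `Λ(P)`, `P ∈ E₁(K)`,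
`‖z P‖ = ‖y‖`.  With `ptLog_add`, `norm_ptLog_eq_of_unramified` and `ptLog_eq_zero_iff_of_unramified`:
**`log_ω : E₁(K) ⥲ 𝔪_K = p𝒪_K` is an isometric isomorphism of groups for EVERY reduction type** — the twin of
n1011's additive `exists_ptLog_eq_of_addv`. [cite: SilvermanAEC2009, IV.6.4] -/
theorem exists_ptLog_eq_of_unramified (hp2 : p ≠ 2) (hK : ∀ x : K, ‖x‖ < 1 → ‖x‖ ≤ ‖(p : K)‖)
    {y : K} (hy : ‖y‖ < 1) :
    ∃ P ∈ kernel (NormedField.valuation (K := K)) (curveK p K M), ptLog p K M P = y ∧ ‖P.zCoord‖ = ‖y‖ :=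
  exists_ptLog_eq_of_norm_le_prime hp2 (hK y hy)

/-- The image statement: **`Λ(E₁(K)) = {y : ‖y‖ ≤ p⁻¹} = p𝒪_K`** (unramified `K`, `p` odd, any model `M`).
[cite: SilvermanAEC2009, IV.6.4] -/
theorem image_ptLog_kernel_of_unramified (hp2 : p ≠ 2) (hK : ∀ x : K, ‖x‖ < 1 → ‖x‖ ≤ ‖(p : K)‖) :
    ptLog p K M '' (kernel (NormedField.valuation (K := K)) (curveK p K M) : Set _) =
      {y : K | ‖y‖ ≤ (p : ℝ)⁻¹} := by
  ext y
  constructor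
  · rintro ⟨P, hP, rfl⟩
    rw [Set.mem_setOf_eq, ← HondaFss.norm_natCast_p (p := p) (K := K)]
    exact norm_ptLog_le_norm_prime_of_unramified hp2 hK hP
  · intro hy
    rw [Set.mem_setOf_eq, ← HondaFss.norm_natCast_p (p := p) (K := K)] at hy
    obtain ⟨P, hP, hPy, -⟩ := exists_ptLog_eq_of_norm_le_prime (p := p) (M := M) hp2 hy
    exact ⟨P, hP, hPy⟩

/-! ## §5 The same in the saturated-log currency `Λ̃ = KPort.satLog` (any model `M`) -/

/-- **Unramified `K`, `p` odd: `Λ̃ P = 0 ↔ P` is torsion**, for `P ∈ Ẽ₁(K)` (`Λ̃ P = Λ(n•P)/n` and `Λ` is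
injective on `E₁(K)`); so `ker Λ̃ = Ẽ₁(K)_tors` — the reduction-free twin of gen 0's
`satLog_eq_zero_iff_isOfFinAddOrder_of_addv`. [cite: SilvermanAEC2009, IV.6.4 and Prop. VII.2.2] -/
theorem satLog_eq_zero_iff_isOfFinAddOrder_of_unramified (hp2 : p ≠ 2)
    (hK : ∀ x : K, ‖x‖ < 1 → ‖x‖ ≤ ‖(p : K)‖)
    {P : (curveK p K M).toAffine.Point} (hP : P ∈ satKernel p K M) :
    satLog p K M P = 0 ↔ IsOfFinAddOrder P := by
  haveI : CharZero K := charZero_of_injective_algebraMap (algebraMap ℚ_[p] K).injective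
  obtain ⟨n, hn, hnP⟩ := mem_satKernel_iff.mp hP
  rw [satLog_eq_div hn hnP, div_eq_zero_iff, or_iff_left (Nat.cast_ne_zero.mpr hn.ne'),
    ptLog_eq_zero_iff_of_unramified hp2 hK hnP, isOfFinAddOrder_iff_nsmul_eq_zero]
  constructor
  · exact fun h => ⟨n, hn, h⟩
  · rintro ⟨m, hm, hmP⟩
    -- `n • P ∈ E₁(K)` is torsion (`m • (n • P) = 0`), and `E₁(K)` has no torsion
    have hmn : m • (n • P) = 0 := by rw [← mul_nsmul, mul_comm, mul_nsmul, hmP, nsmul_zero]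
    have hmnP : m • (n • P) ∈ kernel (NormedField.valuation (K := K)) (curveK p K M) :=
      (kernel (NormedField.valuation (K := K)) _).nsmul_mem hnP m
    have h0 : ptLog p K M (m • (n • P)) = 0 := by rw [hmn, ptLog_zero]
    rw [ptLog_nsmul hnP m, mul_eq_zero, or_iff_right (Nat.cast_ne_zero.mpr hm.ne')] at h0
    exact (ptLog_eq_zero_iff_of_unramified hp2 hK hnP).mp h0

/-- **The SAT₀ bound without `Addv`: `‖Λ̃(P)‖ ≤ 1` whenever `p • P ∈ E₁(K)`** (unramified `K`, `p` odd):
`p Λ̃(P) = Λ(p•P) ∈ p𝒪_K`. [cite: SilvermanAEC2009, IV.6.4 and Prop. VII.2.2] -/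
theorem norm_satLog_le_one_of_prime_nsmul_mem_of_unramified (hp2 : p ≠ 2)
    (hK : ∀ x : K, ‖x‖ < 1 → ‖x‖ ≤ ‖(p : K)‖)
    {P : (curveK p K M).toAffine.Point}
    (hP : p • P ∈ kernel (NormedField.valuation (K := K)) (curveK p K M)) :
    ‖satLog p K M P‖ ≤ 1 :=
  norm_satLog_le_one_of_prime_nsmul hP (norm_ptLog_le_norm_prime_of_unramified hp2 hK hP)

/-- **`p` odd: every `y ∈ p𝒪_K` is `Λ̃(P) = Λ(P)` for some `P ∈ E₁(K)` with `‖z P‖ = ‖y‖`** (any complete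
ultrametric `K`, any model `M`). [cite: SilvermanAEC2009, IV.6.4 and Prop. VII.2.2] -/
theorem exists_mem_kernel_satLog_eq_of_odd (hp2 : p ≠ 2) {y : K} (hy : ‖y‖ ≤ ‖(p : K)‖) :
    ∃ P ∈ kernel (NormedField.valuation (K := K)) (curveK p K M),
      satLog p K M P = y ∧ ‖P.zCoord‖ = ‖y‖ := by
  obtain ⟨P, hP, hPy, hPz⟩ := exists_ptLog_eq_of_norm_le_prime (p := p) (M := M) hp2 hy
  exact ⟨P, hP, by rw [satLog_of_mem hP, hPy], hPz⟩

/-- ★ The image statement in kport's currency: **`Λ̃(E₁(K)) = {y : ‖y‖ ≤ p⁻¹} = p𝒪_K`** for an UNRAMIFIED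
complete `K ⊇ ℚ_p`, `p` odd, and ANY `p`-integral model `M/ℤ_p` — gen 0's `image_satLog_kernel_of_addv`
without the additivity hypothesis. [cite: SilvermanAEC2009, IV.6.4 and Prop. VII.2.2] -/
theorem image_satLog_kernel_of_unramified (hp2 : p ≠ 2) (hK : ∀ x : K, ‖x‖ < 1 → ‖x‖ ≤ ‖(p : K)‖) :
    satLog p K M '' (kernel (NormedField.valuation (K := K)) (curveK p K M) : Set _) =
      {y : K | ‖y‖ ≤ (p : ℝ)⁻¹} := by
  ext y
  constructor
  · rintro ⟨P, hP, rfl⟩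
    rw [Set.mem_setOf_eq, ← HondaFss.norm_natCast_p (p := p) (K := K), satLog_of_mem hP]
    exact norm_ptLog_le_norm_prime_of_unramified hp2 hK hP
  · intro hy
    rw [Set.mem_setOf_eq, ← HondaFss.norm_natCast_p (p := p) (K := K)] at hy
    obtain ⟨P, hP, hPy, -⟩ := exists_mem_kernel_satLog_eq_of_odd (p := p) (M := M) hp2 hy
    exact ⟨P, hP, hPy⟩

end Summit.BirchSwinnertonDyer.BirchSwinnertonDyer.Theorems.KPort

end
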